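import Summits.QuantumAdvantage.AdviceFreeQNC0.SparseOfGap
import Literature.Computability.MetaComplexity.LowDegreeComposition
import Literature.Computability.MetaComplexity.RazborovSmolenskyPoly
import HarnessLib

/-!
# Cell qa-qnc0 (odd primes `p ≥ 5`, rung R3): the FIBRE over a cut-free bit interval — toolkit I

Planner qa-qnc0-p2 g13, ROUND-13 §1 (fibre form) / §2 (rung R3 `WalkHardFGap p`) / §4.  For a strategy `y` and a
CUT-FREE bit interval `E = [i, i+L)` (`CutFree i L y`, `SparseOfGap.lean`), fix the bits outside `E` and vary the
bits `z ∈ {0,1}^L` inside: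

* `GapFibre.ow i L u z` — overwrite the `E`-bits of `u` by `z`; `GapFibre.res` reads them back;
  **`GapFibre.sum_fibre`**: `2^L·Σ_u f(u) = Σ_u Σ_z f(ow u z)` (the map `(u, z) ↦ (ow u z, u|_E)` is an involution
  of `Q × {0,1}^L`) — the double count that turns per-fibre loss bounds into a global one;
* weight bookkeeping `wt_ow`, `wtPrefix_ow_of_le/ge`, and **`exponent_ow`**: for a cut `g` not strictly inside `E`,
  `c + g + walkExp (ow u z) g = κ_g(u) + speed_g · wt z` with `speed_g = 1` for `g ≤ i` (the prefix sees none of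
  `E`) and `speed_g = 2` for `g ≥ i + L` (the prefix sees all of `E`, and `wt` sees it once more) — the planner's
  "two-speed" form.

Sequel: `WalkGapNaming.lean` (the fibre game, the named losing residue, degrees) and `WalkHardFGap.lean` (R3).
WHAT THIS IS NOT: pure bookkeeping; nothing here is a hardness statement; separation NOT moved.
-/

noncomputable section

namespace Summit.QuantumAdvantage.AdviceFreeQNC0

open Classical
open Finset
open Literature.Computability.MetaComplexity Literature.Computability.MetaComplexity.Smolensky

variable {n : ℕ}

namespace GapFibre

/-! ### The overwrite map on the bit interval `E = [i, i+L)` -/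

/-- Overwrite the bits of `u` in `E = [i, i+L)` by `z`. -/
def ow (i L : ℕ) (u : Fin n → Bool) (z : Fin L → Bool) : Fin n → Bool :=
  fun b => if h : i ≤ b.val ∧ b.val < i + L then z ⟨b.val - i, by omega⟩ else u b

/-- Read the bits of `u` in `E` (needs `i + L ≤ n`). -/
def res (i L : ℕ) (hiL : i + L ≤ n) (u : Fin n → Bool) : Fin L → Bool :=
  fun j => u ⟨i + j.val, by omega⟩

/-- Inside `E` the overwrite reads `z`. -/
theorem ow_of_inE {i L : ℕ} (u : Fin n → Bool) (z : Fin L → Bool) {b : Fin n} (h : i ≤ b.val ∧ b.val < i + L) :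
    ow i L u z b = z ⟨b.val - i, by omega⟩ := by
  unfold ow; rw [dif_pos h]

/-- Outside `E` the overwrite reads `u`. -/
theorem ow_of_not_inE {i L : ℕ} (u : Fin n → Bool) (z : Fin L → Bool) {b : Fin n}
    (h : ¬ (i ≤ b.val ∧ b.val < i + L)) : ow i L u z b = u b := by
  unfold ow; rw [dif_neg h]

/-- Reading back the overwritten bits. -/
theorem res_ow {i L : ℕ} (hiL : i + L ≤ n) (u : Fin n → Bool) (z : Fin L → Bool) :
    res i L hiL (ow i L u z) = z := by
  funext j
  unfold res
  rw [ow_of_inE u z (b := ⟨i + j.val, by omega⟩) (by simp only; omega)]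
  congr 1
  exact Fin.ext (by simp)

/-- Overwriting twice: the second overwrite wins; overwriting with the original bits restores `u`. -/
theorem ow_ow_res {i L : ℕ} (hiL : i + L ≤ n) (u : Fin n → Bool) (z : Fin L → Bool) :
    ow i L (ow i L u z) (res i L hiL u) = u := by
  funext b
  by_cases h : i ≤ b.val ∧ b.val < i + L
  · rw [ow_of_inE _ _ h]
    unfold res
    congr 1
    exact Fin.ext (by simp only; omega)
  · rw [ow_of_not_inE _ _ h, ow_of_not_inE _ _ h]

/-- **Fibre double counting**: `2^L · Σ_u f(u) = Σ_u Σ_z f(ow u z)` (the map `(u,z) ↦ (ow u z, u|_E)` is an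
involution of `Q × {0,1}^L`). -/
theorem sum_fibre {i L : ℕ} (hiL : i + L ≤ n) (f : (Fin n → Bool) → ℝ) :
    (2 : ℝ) ^ L * ∑ u : Fin n → Bool, f u = ∑ u : Fin n → Bool, ∑ z : Fin L → Bool, f (ow i L u z) := by
  have hinv : Function.Involutive (fun q : (Fin n → Bool) × (Fin L → Bool) =>
      (ow i L q.1 q.2, res i L hiL q.1)) := by
    rintro ⟨u, z⟩
    simp only [Prod.mk.injEq]
    exact ⟨ow_ow_res hiL u z, res_ow hiL u z⟩
  rw [← Fintype.sum_prod_type' (fun u z => f (ow i L u z))]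
  rw [show (∑ q : (Fin n → Bool) × (Fin L → Bool), f (ow i L q.1 q.2)) =
      ∑ q : (Fin n → Bool) × (Fin L → Bool), f ((Function.Involutive.toPerm _ hinv) q).1 from
    Fintype.sum_congr _ _ (fun q => by rw [Function.Involutive.coe_toPerm])]
  rw [Equiv.sum_comp (Function.Involutive.toPerm _ hinv) (fun q : (Fin n → Bool) × (Fin L → Bool) => f q.1)]
  rw [Fintype.sum_prod_type]
  simp only [Finset.sum_const, Finset.card_univ, Fintype.card_fun, Fintype.card_bool, Fintype.card_fin,
    nsmul_eq_mul, Nat.cast_pow, Nat.cast_ofNat]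
  rw [Finset.mul_sum]

/-! ### Weight bookkeeping across the fibre -/

/-- The weight of `u` OFF the interval `E`. -/
def wtOff (i L : ℕ) (u : Fin n → Bool) : ℕ :=
  (univ.filter fun b : Fin n => ¬ (i ≤ b.val ∧ b.val < i + L) ∧ u b = true).card

/-- The prefix weight of `u` before cut `g`, OFF the interval `E`. -/
def preOff (i L : ℕ) (u : Fin n → Bool) (g : ℕ) : ℕ :=
  (univ.filter fun b : Fin n => b.val < g ∧ ¬ (i ≤ b.val ∧ b.val < i + L) ∧ u b = true).card

/-- The bits of `E` that are set in `ow u z` are counted by `wt z`. -/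
theorem card_inE_ow {i L : ℕ} (hiL : i + L ≤ n) (u : Fin n → Bool) (z : Fin L → Bool) :
    (univ.filter fun b : Fin n => (i ≤ b.val ∧ b.val < i + L) ∧ ow i L u z b = true).card = wt z := by
  unfold wt
  -- the bits of `E` are the image of `Fin L` under `j ↦ i + j`
  have himg : (univ.filter fun b : Fin n => (i ≤ b.val ∧ b.val < i + L) ∧ ow i L u z b = true) =
      (univ.filter fun j : Fin L => z j = true).image (fun j : Fin L => (⟨i + j.val, by omega⟩ : Fin n)) := by
    ext b
    simp only [mem_filter, mem_univ, true_and, mem_image]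
    constructor
    · rintro ⟨hb, hzb⟩
      refine ⟨⟨b.val - i, by omega⟩, ?_, Fin.ext (by simp only; omega)⟩
      rw [ow_of_inE u z hb] at hzb
      exact hzb
    · rintro ⟨j, hj, rfl⟩
      refine ⟨by simp only; omega, ?_⟩
      rw [ow_of_inE u z (b := ⟨i + j.val, by omega⟩) (by simp only; omega)]
      have : (⟨(⟨i + j.val, by omega⟩ : Fin n).val - i, by simp only; omega⟩ : Fin L) = j :=
        Fin.ext (by simp)
      rw [this]; exact hj
  rw [himg, Finset.card_image_of_injective _ (fun j j' h => by
    have := congrArg Fin.val h; exact Fin.ext (by simp only at this; omega))]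

/-- `wt (ow u z) = wtOff u + wt z`. -/
theorem wt_ow {i L : ℕ} (hiL : i + L ≤ n) (u : Fin n → Bool) (z : Fin L → Bool) :
    wt (ow i L u z) = wtOff i L u + wt z := by
  rw [← card_inE_ow hiL u z]
  unfold wt wtOff
  rw [← Finset.card_union_of_disjoint]
  · congr 1
    ext b
    simp only [mem_filter, mem_univ, true_and, mem_union]
    constructor
    · intro hb
      by_cases h : i ≤ b.val ∧ b.val < i + L
      · exact Or.inr ⟨h, hb⟩
      · exact Or.inl ⟨h, by rwa [ow_of_not_inE u z h] at hb⟩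
    · rintro (⟨h, hb⟩ | ⟨h, hb⟩)
      · rwa [ow_of_not_inE u z h]
      · exact hb
  · rw [Finset.disjoint_filter]
    intro b _ h1 h2
    exact h1.1 h2.1

/-- Prefix weights of `ow u z` at a cut weakly LEFT of `E`: only off-`E` bits are counted. -/
theorem wtPrefix_ow_of_le {i L : ℕ} (u : Fin n → Bool) (z : Fin L → Bool) {g : ℕ} (hg : g ≤ i) :
    wtPrefix (ow i L u z) g = preOff i L u g := by
  unfold wtPrefix preOff
  congr 1
  ext b
  simp only [mem_filter, mem_univ, true_and]
  constructor
  · rintro ⟨hb, hob⟩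
    have h : ¬ (i ≤ b.val ∧ b.val < i + L) := by omega
    exact ⟨hb, h, by rwa [ow_of_not_inE u z h] at hob⟩
  · rintro ⟨hb, h, hub⟩
    exact ⟨hb, by rwa [ow_of_not_inE u z h]⟩

/-- Prefix weights of `ow u z` at a cut weakly RIGHT of `E`: all of `E` is counted. -/
theorem wtPrefix_ow_of_ge {i L : ℕ} (hiL : i + L ≤ n) (u : Fin n → Bool) (z : Fin L → Bool) {g : ℕ}
    (hg : i + L ≤ g) : wtPrefix (ow i L u z) g = preOff i L u g + wt z := by
  unfold wtPrefix preOff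
  rw [← card_inE_ow hiL u z, ← Finset.card_union_of_disjoint]
  · congr 1
    ext b
    simp only [mem_filter, mem_univ, true_and, mem_union]
    constructor
    · rintro ⟨hb, hob⟩
      by_cases h : i ≤ b.val ∧ b.val < i + L
      · exact Or.inr ⟨h, hob⟩
      · exact Or.inl ⟨hb, h, by rwa [ow_of_not_inE u z h] at hob⟩
    · rintro (⟨hb, h, hub⟩ | ⟨h, hob⟩)
      · exact ⟨hb, by rwa [ow_of_not_inE u z h]⟩
      · exact ⟨by omega, hob⟩
  · rw [Finset.disjoint_filter]
    intro b _ h1 h2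
    exact h1.2.1 h2.1

/-- The fibre constant of cut `g` (charge included): `κ = c + g + wtOff + preOff`. -/
def kappa (i L c : ℕ) (u : Fin n → Bool) (g : ℕ) : ℕ := c + g + wtOff i L u + preOff i L u g

/-- The speed of cut `g`: `1` left of `E`, `2` right of `E`. -/
def speed (i g : ℕ) : ℕ := if g ≤ i then 1 else 2

/-- **Exponent decomposition in the fibre**: for a cut not strictly inside `E`,
`c + g + walkExp (ow u z) g = κ_g(u) + speed_g · wt z`. -/
theorem exponent_ow {i L : ℕ} (hiL : i + L ≤ n) (c : ℕ) (u : Fin n → Bool) (z : Fin L → Bool) {g : ℕ}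
    (hg : g ≤ i ∨ i + L ≤ g) :
    c + g + walkExp (ow i L u z) g = kappa i L c u g + speed i g * wt z := by
  unfold walkExp kappa speed
  rw [wt_ow hiL]
  rcases hg with hg | hg
  · rw [wtPrefix_ow_of_le u z hg, if_pos hg]; ring
  · by_cases hgi : g ≤ i
    · -- then `L = 0`
      have hL : L = 0 := by omega
      rw [wtPrefix_ow_of_le u z hgi, if_pos hgi]
      have hz : wt z = 0 := by
        unfold wt; subst hL
        rw [Finset.card_eq_zero]; ext j; exact Fin.elim0 j
      rw [hz]; ring
    · rw [wtPrefix_ow_of_ge hiL u z hg, if_neg hgi]; ring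

end GapFibre

end Summit.QuantumAdvantage.AdviceFreeQNC0

end
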